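import Summits.AtomisticToContinuum.FouriersLaw.Theses.CageBudgetFekete

/-!
# Typed companion of STRATEGY-CENSUS §s3-E (crux-strategist seat 12596-s2, instance E, 2026-08-17)

Crux: `CageBudgetFekete.AbelThermodynamicLimit` (stmt-AtomisticToContinuum-12596; `rfl`-equal on the
four sharing routes).  This file TYPE-CHECKS the new census objects over tree declarations; nothing
here is filed as an item (a strategist files lines / splits / ideas only).

* `openAbel`        — `F_N(ν; γ)`, the open chain's Abel-regularised equilibrium total-current
                      autocorrelation (the integrand of `UniformAbelianRegularity`, with the bath
                      coupling `γ` exposed as a variable).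
* `GammaHarnack`    — §Strengthen S21-E: two-sided monotonicity in the COUPLING,
                      `γ ↦ F_N(ν;γ)/γ` antitone and `γ ↦ γ·F_N(ν;γ)` monotone, every `N, ν > 0`
                      (from the exact identity `∂_γ F = ‖u_e‖²_S − ‖u_o‖²_S`, `F ≥ γ(‖u_e‖²_S + ‖u_o‖²_S)`,
                      `u = (ν − L_{N,γ})⁻¹J` split by momentum-reversal parity). Candidate LEMMA (M-sized,
                      provable from dissipativity + time-reversal covariance `L* = ΘLΘ`, `ΘJ = −J`);
                      no leverage on (R), γ-transfer of positivity/finiteness for CLB / HasBoundedResponse.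
* `HydrostaticFourier`, `UniformCubicResponse` — §Decomposition D22-E: the NESS-side `(N, δ)` exchange.
* `responseConverges_of_hydrostatic_of_uniformCubic` — the glue (HS) ∧ (U3) ⟹ "the responses converge to
  some κ' > 0" (clause (ii)-strength; `Uniq` = landed `Theorems.nessUnique_proof` makes κ' canonical),
  kernel-checked; abstract core `tendsto_response_of_hydrostatic_of_uniformCubic`.
-/

noncomputable section

open MeasureTheory Filter Set Topology
open Literature.MathematicalPhysics.KineticTheory.HeatConduction

namespace Summit.AtomisticToContinuum.FouriersLaw.Cruxes.AbelThermodynamicLimit.StrategistS3E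

/-- `F_N(ν; γ)`: the open `N`-chain (both baths at `T`, coupling `γ`) Abel-regularised total-current
autocorrelation `∫₀^∞ e^{-νt} c_N(t) dt`, written exactly as inside `UniformAbelianRegularity`. -/
def openAbel (ω₂ lam β γ T ν : ℝ) (N : ℕ) : ℝ :=
  ∫ t in Set.Ioi (0:ℝ), Real.exp (-(ν * t)) *
    ∫ z, (∑ i : Fin N, (pinnedChain ω₂ lam β γ).bondCurrent N i z) *
      (∫ y, (∑ i : Fin N, (pinnedChain ω₂ lam β γ).bondCurrent N i y)
        ∂((pinnedChain ω₂ lam β γ).transitionKernel N T T t.toNNReal z))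
      ∂((pinnedChain ω₂ lam β γ).gibbsMeasure N T)

/-- **S21-E `GammaHarnack`** (candidate lemma, NOT filed): boundary-Harnack in the bath coupling —
for `0 < γ₁ ≤ γ₂`, `F_N(ν;γ₂)/γ₂ ≤ F_N(ν;γ₁)/γ₁` and `γ₁F_N(ν;γ₁) ≤ γ₂F_N(ν;γ₂)`, every `N`, every `ν > 0`.
With the landed (K) `(N−1)T²D_N = F_N(0⁺)` it gives `D_N(γ₂)/γ₂ ≤ D_N(γ₁)/γ₁`, `γ₁D_N(γ₁) ≤ γ₂D_N(γ₂)`. -/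
def GammaHarnack : Prop :=
  ∀ ω₂ lam β : ℝ, 0 < ω₂ → 0 < lam → 0 < β → ∀ T : ℝ, 0 < T → ∀ ν : ℝ, 0 < ν → ∀ N : ℕ,
    ∀ γ₁ γ₂ : ℝ, 0 < γ₁ → γ₁ ≤ γ₂ →
      openAbel ω₂ lam β γ₂ T ν N / γ₂ ≤ openAbel ω₂ lam β γ₁ T ν N / γ₁ ∧
      γ₁ * openAbel ω₂ lam β γ₁ T ν N ≤ γ₂ * openAbel ω₂ lam β γ₂ T ν N

/-- **D22-E (HS) `HydrostaticFourier`**: Fourier's law in the NESS at FINITE temperature difference,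
near equilibrium — for every steady family, at each fixed small `δ > 0` the total steady current
`(N−1)J_N(T+δ/2, T−δ/2)` has a limit `K δ` as `N → ∞`, and `K δ / δ → κ' > 0` as `δ ↓ 0`
(BLR 2000 eq. (33) with the limits in the opposite order). Summit-class. -/
def HydrostaticFourier : Prop :=
  ∀ ω₂ lam β γ : ℝ, 0 < ω₂ → 0 < lam → 0 < β → 0 < γ → ∀ T : ℝ, 0 < T →
    ∀ μ : (N : ℕ) → ℝ → ℝ → Measure (PhaseSpace N),
      (∀ (N : ℕ) (T_L T_R : ℝ), 0 < T_L → 0 < T_R →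
        (pinnedChain ω₂ lam β γ).IsSteadyState N T_L T_R (μ N T_L T_R)) →
      ∃ K : ℝ → ℝ, ∃ δ₀ : ℝ, 0 < δ₀ ∧
        (∀ δ : ℝ, 0 < δ → δ < δ₀ →
          Tendsto (fun N : ℕ => (pinnedChain ω₂ lam β γ).totalCurrent (μ N (T + δ / 2) (T - δ / 2)))
            atTop (𝓝 (K δ))) ∧
        ∃ κ' : ℝ, 0 < κ' ∧ Tendsto (fun δ : ℝ => K δ / δ) (𝓝[>] 0) (𝓝 κ')

/-- **D22-E (U3) `UniformCubicResponse`**: an `N`-UNIFORM cubic remainder for the nonlinear response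
of the total steady current, `|(N−1)J_N(δ) − δ·D_N| ≤ C|δ|³` for `0 < |δ| < δ₀`, `N ≥ N₀`
(the quadratic order vanishes identically by reflection symmetry + NESS uniqueness).
HasBoundedResponse class or harder. -/
def UniformCubicResponse : Prop :=
  ∀ ω₂ lam β γ : ℝ, 0 < ω₂ → 0 < lam → 0 < β → 0 < γ → ∀ T : ℝ, 0 < T →
    ∀ μ : (N : ℕ) → ℝ → ℝ → Measure (PhaseSpace N),
      (∀ (N : ℕ) (T_L T_R : ℝ), 0 < T_L → 0 < T_R →
        (pinnedChain ω₂ lam β γ).IsSteadyState N T_L T_R (μ N T_L T_R)) →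
      ∀ D : ℕ → ℝ,
        (∀ N : ℕ, Tendsto (fun δ : ℝ =>
          (pinnedChain ω₂ lam β γ).totalCurrent (μ N (T + δ / 2) (T - δ / 2)) / δ)
          (𝓝[≠] 0) (𝓝 (D N))) →
        ∃ C δ₀ : ℝ, 0 < δ₀ ∧ ∃ N₀ : ℕ, ∀ N : ℕ, N₀ ≤ N → ∀ δ : ℝ, 0 < |δ| → |δ| < δ₀ →
          |(pinnedChain ω₂ lam β γ).totalCurrent (μ N (T + δ / 2) (T - δ / 2)) - δ * D N| ≤ C * |δ| ^ 3

/-- Abstract core: (U3) ∧ (HS') ∧ (HS'') ⟹ `D N → κ`. [folklore] -/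
theorem tendsto_response_of_hydrostatic_of_uniformCubic
    (f : ℕ → ℝ → ℝ) (D : ℕ → ℝ) (K : ℝ → ℝ) (κ C δ₀ : ℝ) (N₀ : ℕ) (hδ₀ : 0 < δ₀)
    (hU : ∀ N, N₀ ≤ N → ∀ δ, 0 < δ → δ < δ₀ → |f N δ - δ * D N| ≤ C * δ ^ 3)
    (hHS : ∀ δ, 0 < δ → δ < δ₀ → Tendsto (fun N => f N δ) atTop (𝓝 (K δ)))
    (hK : Tendsto (fun δ => K δ / δ) (𝓝[>] 0) (𝓝 κ)) :
    Tendsto D atTop (𝓝 κ) := by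
  rw [Metric.tendsto_atTop]
  intro ε hε
  obtain ⟨δ₁, hδ₁, hKδ⟩ := (Metric.tendsto_nhdsWithin_nhds.mp hK) (ε / 3) (by positivity)
  set A : ℝ := |C| + 1 with hA
  have hApos : 0 < A := by positivity
  set δ : ℝ := min (min (δ₀ / 2) (δ₁ / 2)) (min 1 (ε / (3 * A))) with hδdef
  have hδpos : 0 < δ := by
    simp only [hδdef, lt_min_iff]
    exact ⟨⟨by linarith, by linarith⟩, by norm_num, by positivity⟩
  have hδ0 : δ < δ₀ := by
    have : δ ≤ δ₀ / 2 := (min_le_left _ _).trans (min_le_left _ _)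
    linarith
  have hδ1 : δ < δ₁ := by
    have : δ ≤ δ₁ / 2 := (min_le_left _ _).trans (min_le_right _ _)
    linarith
  have hδle1 : δ ≤ 1 := (min_le_right _ _).trans (min_le_left _ _)
  have hδε : δ ≤ ε / (3 * A) := (min_le_right _ _).trans (min_le_right _ _)
  have h3 : |K δ / δ - κ| < ε / 3 := by
    have := hKδ (x := δ) (by exact hδpos) (by
      rw [Real.dist_eq, sub_zero, abs_of_pos hδpos]; exact hδ1)
    rwa [Real.dist_eq] at this
  obtain ⟨N₁, hN₁⟩ := (Metric.tendsto_atTop.mp (hHS δ hδpos hδ0)) (ε * δ / 3) (by positivity)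
  refine ⟨max N₀ N₁, fun N hN => ?_⟩
  have hu := hU N ((le_max_left _ _).trans hN) δ hδpos hδ0
  have h2 : |f N δ - K δ| < ε * δ / 3 := by
    have := hN₁ N ((le_max_right _ _).trans hN); rwa [Real.dist_eq] at this
  have h1 : |D N - f N δ / δ| < ε / 3 := by
    have hdiv : D N - f N δ / δ = -(f N δ - δ * D N) / δ := by
      field_simp
      ring
    rw [hdiv, abs_div, abs_neg, abs_of_pos hδpos, div_lt_iff₀ hδpos]
    have hC3 : C * δ ^ 3 ≤ |C| * δ ^ 3 :=
      mul_le_mul_of_nonneg_right (le_abs_self C) (by positivity)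
    have hbound : |C| * δ ^ 3 < ε / 3 * δ := by
      have hδ2 : |C| * δ ^ 2 < ε / 3 := by
        have hsq : δ ^ 2 ≤ δ := by nlinarith
        calc |C| * δ ^ 2 ≤ |C| * δ := mul_le_mul_of_nonneg_left hsq (abs_nonneg C)
          _ < A * δ := by
              have : |C| < A := by simp [hA]
              exact mul_lt_mul_of_pos_right this hδpos
          _ ≤ A * (ε / (3 * A)) := mul_le_mul_of_nonneg_left hδε hApos.le
          _ = ε / 3 := by field_simp
      have : |C| * δ ^ 3 = (|C| * δ ^ 2) * δ := by ring
      rw [this]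
      exact mul_lt_mul_of_pos_right hδ2 hδpos
    linarith [hu, hC3, hbound]
  have h2' : |f N δ / δ - K δ / δ| < ε / 3 := by
    rw [← sub_div, abs_div, abs_of_pos hδpos, div_lt_iff₀ hδpos]
    linarith [h2]
  rw [Real.dist_eq]
  calc |D N - κ| = |(D N - f N δ / δ) + (f N δ / δ - K δ / δ) + (K δ / δ - κ)| := by ring_nf
    _ ≤ |D N - f N δ / δ| + |f N δ / δ - K δ / δ| + |K δ / δ - κ| := abs_add_three _ _ _
    _ < ε / 3 + ε / 3 + ε / 3 := by linarith [h1, h2', h3]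
    _ = ε := by ring

/-- **D22-E glue over tree objects**: (HS) ∧ (U3) ⟹ for every steady family and every response
sequence, `D N → κ'` for SOME `κ' > 0` (clause (ii) strength, family by family; the landed NESS
uniqueness makes `κ'` family-independent).  Sorry-free; the two hypotheses are the open pieces. -/
theorem responseConverges_of_hydrostatic_of_uniformCubic
    (hHS : HydrostaticFourier) (hU3 : UniformCubicResponse) :
    ∀ ω₂ lam β γ : ℝ, 0 < ω₂ → 0 < lam → 0 < β → 0 < γ → ∀ T : ℝ, 0 < T →
      ∀ μ : (N : ℕ) → ℝ → ℝ → Measure (PhaseSpace N),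
        (∀ (N : ℕ) (T_L T_R : ℝ), 0 < T_L → 0 < T_R →
          (pinnedChain ω₂ lam β γ).IsSteadyState N T_L T_R (μ N T_L T_R)) →
        ∀ D : ℕ → ℝ,
          (∀ N : ℕ, Tendsto (fun δ : ℝ =>
            (pinnedChain ω₂ lam β γ).totalCurrent (μ N (T + δ / 2) (T - δ / 2)) / δ)
            (𝓝[≠] 0) (𝓝 (D N))) →
          ∃ κ' : ℝ, 0 < κ' ∧ Tendsto D atTop (𝓝 κ') := by
  intro ω₂ lam β γ hω hl hβ hγ T hT μ hμ D hD
  obtain ⟨K, δ₀, hδ₀, hK, κ', hκ', hlim⟩ := hHS ω₂ lam β γ hω hl hβ hγ T hT μ hμ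
  obtain ⟨C, δ₁, hδ₁, N₀, hC⟩ := hU3 ω₂ lam β γ hω hl hβ hγ T hT μ hμ D hD
  refine ⟨κ', hκ', ?_⟩
  refine tendsto_response_of_hydrostatic_of_uniformCubic
    (fun N δ => (pinnedChain ω₂ lam β γ).totalCurrent (μ N (T + δ / 2) (T - δ / 2)))
    D K κ' C (min δ₀ δ₁) N₀ (lt_min hδ₀ hδ₁) ?_ ?_ hlim
  · intro N hN δ hδ hδ'
    have h := hC N hN δ (by rwa [abs_of_pos hδ]) (by rw [abs_of_pos hδ]; exact hδ'.trans_le (min_le_right _ _))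
    rwa [abs_of_pos hδ] at h
  · intro δ hδ hδ'
    exact hK δ hδ (hδ'.trans_le (min_le_left _ _))

end Summit.AtomisticToContinuum.FouriersLaw.Cruxes.AbelThermodynamicLimit.StrategistS3E
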